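import Summits.Ventures.LatticeQCDFlow.Scoring.UNCentreWardIdentity
import HarnessLib

/-!
# Central phases of `U(N)`: unbalanced trace moments vanish, and the moments of `Re tr U` from those of `|tr U|`

HONEST FRAMING: exact (Metropolis-corrected) sampling algorithms for lattice gauge theory;
figures of merit are autocorrelation/cost numbers at stated couplings and volumes; no
continuum-physics claim.

Venture `LatticeQCDFlow` (cell pub-lqcd), sub-topic `Scoring`; FANOUT row 5 (`s0-sun-a`), GEN-23.
NEW WORK of the cell (placement rule).  Elementary Haar-invariance facts used by
`UNHaarTraceMomentsTableaux` to pass from the trace moments `∫_{U(N)} |tr U|^{2n} dU` to the moments of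
the one-plaquette observable `Re tr U` (whose moment generating function is the `U(N)` one-plaquette
partition function `det[I_{|i−j|}(x)]`, `OnePlaquetteHaarMGF`):

* §0 Weyl-side preliminaries for `UNHaarTraceMomentsTableaux`: `tr diag(e^{iθ}) = Σ_b e^{iθ_b}` and the
  integrability of the angle integrand `|Σ_b e^{iθ_b}|^{2n} Π_{j≺k}|e^{iθ_j} − e^{iθ_k}|²` on the cube;
* §1 **`∫_{U(N)} (tr U)^j (conj tr U)^l dU = 0` for `j ≠ l`** (`integral_trace_pow_mul_conj_trace_pow_eq_zero`:
  left invariance under the central phase `e^{iπ/(j−l)}·1` of `UNCentreWardIdentity`, under which the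
  integrand changes sign — the tree's `un_integral_trace_eq_zero` / `un_integral_trace_sq_eq_zero` of
  `TrivializingMaps.UNHaarTraceMoments` are the cases `(1,0)`, `(2,0)`);
* §2 the binomial expansion of `(Re z)^k = 2^{−k}(z + z̄)^k` then gives **`∫ (Re tr U)^{2m+1} dU = 0`**
  (`integral_re_trace_pow_odd`) and **`∫ (Re tr U)^{2m} dU = 4^{−m} C(2m,m) ∫ |tr U|^{2m} dU`**
  (`integral_re_trace_pow_even`), every `N`, `m`;
* §3 the `U(N)` one-plaquette partition function `Z_N(x) = det[I_{|i−j|}(x)]_{N×N}` (`= mgf` of `Re tr U`,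
  `OnePlaquetteHaarMGF`): `Z_N^{(k)}(0) = ∫ (Re tr U)^k dU` (Mathlib's `iteratedDeriv_mgf_zero`) and the
  everywhere-convergent moment series `Z_N(x) = Σ_k (x^k/k!) ∫(Re tr U)^k dU`,
  `Z_N'(x) = Σ_k (x^k/k!) ∫(Re tr U)^{k+1} dU` (dominated convergence).

No `def`, no named fact, 0 sorry.
-/

noncomputable section

open Real MeasureTheory Finset Complex ProbabilityTheory
open scoped ComplexConjugate
open Literature.MathematicalPhysics.QuantumFieldTheory (haarProbability)
open Literature.RepresentationTheory.CompactGroups.WeylIntegration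
open Literature.Analysis.FunctionSpaces

namespace Summit.Ventures.LatticeQCDFlow.Scoring

variable {N : ℕ}

/-! ### 0. Weyl-side preliminaries: the trace of the torus point and the angle integrand of `|tr U|^{2n}` -/

/-- The trace of the torus point `diag(e^{iθ})` is `Σ_b e^{iθ_b}`. -/
theorem trace_torusPt (θ : Fin N → ℝ) :
    (((torusPt θ : Literature.LinearAlgebra.Matrix.diagonalTorus (Fin N)) : Matrix.unitaryGroup (Fin N) ℂ) :
        Matrix (Fin N) (Fin N) ℂ).trace = ∑ b, cexp (θ b * I) := by
  rw [coe_torusPt, Matrix.trace_diagonal]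

/-- The angle integrand `|Σ_b e^{iθ_b}|^{2n} Π_{j≺k}|e^{iθ_j} − e^{iθ_k}|²` is integrable on the cube. -/
theorem integrable_cube_norm_sum_cexp_pow_mul_prod (n : ℕ) :
    Integrable (fun θ : Fin N → ℝ =>
        ‖∑ b, cexp (θ b * I)‖ ^ (2 * n) * ∏ p : OD (Fin N), ‖cexp (θ p.1.1 * I) - cexp (θ p.1.2 * I)‖ ^ 2)
      (Measure.pi fun _ : Fin N => (volume : Measure ℝ).restrict (Set.Ioc (-π) π)) := by
  refine Integrable.mono' (integrable_const (((N : ℝ) ^ (2 * n)) * (2 ^ Fintype.card (OD (Fin N))) ^ 2))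
    ?_ (Filter.Eventually.of_forall fun θ => ?_)
  · exact ((continuous_finsetSum _ fun b _ => by fun_prop).norm.pow _).mul
      (continuous_finsetProd _ fun p _ => by fun_prop) |>.aestronglyMeasurable
  · rw [Real.norm_of_nonneg (mul_nonneg (pow_nonneg (norm_nonneg _) _)
      (Finset.prod_nonneg fun p _ => sq_nonneg _)), prod_OD_norm_sub_sq_eq_norm_vdm_sq]
    refine mul_le_mul (pow_le_pow_left₀ (norm_nonneg _) ?_ _) (norm_vdm_sq_le θ) (sq_nonneg _) (by positivity)
    calc ‖∑ b, cexp (θ b * I)‖ ≤ ∑ b, ‖cexp (θ b * I)‖ := norm_sum_le _ _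
      _ = N := by simp [Complex.norm_exp_ofReal_mul_I]

/-! ### 1. Unbalanced trace moments vanish -/

/-- **Unbalanced trace moments of a Haar unitary vanish**: `∫_{U(N)} (tr U)^j (conj tr U)^l dU = 0` for
`j ≠ l` (left invariance under the central phase `e^{iπ/(j−l)}·1`, under which the integrand changes sign). -/
theorem integral_trace_pow_mul_conj_trace_pow_eq_zero {j l : ℕ} (hjl : j ≠ l) :
    ∫ U, ((U : Matrix (Fin N) (Fin N) ℂ)).trace ^ j * conj (((U : Matrix (Fin N) (Fin N) ℂ)).trace) ^ l
      ∂(haarProbability (Matrix.unitaryGroup (Fin N) ℂ)) = 0 := by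
  set μ := haarProbability (Matrix.unitaryGroup (Fin N) ℂ) with hμ
  set D : ℤ := (j : ℤ) - (l : ℤ) with hD
  have hD0 : D ≠ 0 := by rw [hD]; omega
  have hcc : cexp (((π / D : ℝ) : ℂ) * I) ^ j * conj (cexp (((π / D : ℝ) : ℂ) * I)) ^ l = -1 := by
    have hconj : conj (cexp (((π / D : ℝ) : ℂ) * I)) = cexp (-(((π / D : ℝ) : ℂ) * I)) := by
      rw [← Complex.exp_conj, map_mul, Complex.conj_ofReal, Complex.conj_I, mul_neg]
    rw [hconj, ← Complex.exp_nat_mul, ← Complex.exp_nat_mul, ← Complex.exp_add, ← Complex.exp_pi_mul_I]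
    congr 1
    have hDc : ((D : ℝ) : ℂ) ≠ 0 := by exact_mod_cast hD0
    have hjl' : (j : ℂ) - (l : ℂ) = ((D : ℝ) : ℂ) := by rw [hD]; push_cast; ring
    rw [show (j : ℂ) * (((π / D : ℝ) : ℂ) * I) + l * -(((π / D : ℝ) : ℂ) * I)
        = ((j : ℂ) - l) * ((π / D : ℝ) : ℂ) * I by ring, hjl']
    push_cast
    field_simp
  have key := integral_mul_left_eq_self (μ := μ)
    (fun U : Matrix.unitaryGroup (Fin N) ℂ =>
      ((U : Matrix (Fin N) (Fin N) ℂ)).trace ^ j * conj (((U : Matrix (Fin N) (Fin N) ℂ)).trace) ^ l)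
    ⟨cexp (((π / D : ℝ) : ℂ) * I) • 1, exp_mul_I_smul_one_mem_unitaryGroup N (π / D)⟩
  simp only [trace_centre_mul, mul_pow, map_mul] at key
  have hfac : ∀ U : Matrix.unitaryGroup (Fin N) ℂ,
      cexp (((π / D : ℝ) : ℂ) * I) ^ j * ((U : Matrix (Fin N) (Fin N) ℂ)).trace ^ j *
          (conj (cexp (((π / D : ℝ) : ℂ) * I)) ^ l * conj (((U : Matrix (Fin N) (Fin N) ℂ)).trace) ^ l)
        = (cexp (((π / D : ℝ) : ℂ) * I) ^ j * conj (cexp (((π / D : ℝ) : ℂ) * I)) ^ l) *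
            (((U : Matrix (Fin N) (Fin N) ℂ)).trace ^ j * conj (((U : Matrix (Fin N) (Fin N) ℂ)).trace) ^ l) :=
    fun U => by ring
  simp_rw [hfac, hcc] at key
  rw [integral_const_mul] at key
  linear_combination (-(1 : ℂ) / 2) * key

/-! ### 2. The moments of `Re tr U` -/

/-- `(Re z)^k` through the binomial expansion of `(z + z̄)^k`. -/
theorem ofReal_re_pow_eq_sum (z : ℂ) (k : ℕ) :
    ((z.re ^ k : ℝ) : ℂ) = (2 : ℂ)⁻¹ ^ k * ∑ i ∈ range (k + 1), z ^ i * conj z ^ (k - i) * (k.choose i : ℂ) := by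
  rw [← add_pow, Complex.add_conj, ← mul_pow]
  push_cast
  ring

/-- Integrability of the complex trace monomials on `U(N)`. -/
theorem integrable_trace_pow_mul_conj_trace_pow (j l : ℕ) :
    Integrable (fun U : Matrix.unitaryGroup (Fin N) ℂ =>
        ((U : Matrix (Fin N) (Fin N) ℂ)).trace ^ j * conj (((U : Matrix (Fin N) (Fin N) ℂ)).trace) ^ l)
      (haarProbability (Matrix.unitaryGroup (Fin N) ℂ)) :=
  TrivializingMaps.integrable_haarUN_of_continuous
    ((continuous_subtype_val.matrix_trace.pow _).mul ((Complex.continuous_conj.comp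
      continuous_subtype_val.matrix_trace).pow _))

/-- **The moments of `Re tr U` from the trace moments**: for every `k`,
`∫_{U(N)} (Re tr U)^k dU = 2^{−k} Σ_i C(k,i) ∫ (tr U)^i (conj tr U)^{k−i} dU`, in which only a balanced term
`i = k − i` survives. Odd moments vanish. -/
theorem integral_re_trace_pow_odd (m : ℕ) :
    ∫ U, ((U : Matrix (Fin N) (Fin N) ℂ)).trace.re ^ (2 * m + 1)
      ∂(haarProbability (Matrix.unitaryGroup (Fin N) ℂ)) = 0 := by
  set μ := haarProbability (Matrix.unitaryGroup (Fin N) ℂ) with hμ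
  have h : ((∫ U, ((U : Matrix (Fin N) (Fin N) ℂ)).trace.re ^ (2 * m + 1) ∂μ : ℝ) : ℂ) = 0 := by
    rw [← integral_complex_ofReal]
    simp_rw [ofReal_re_pow_eq_sum]
    rw [integral_const_mul, integral_finsetSum _ (fun i _ =>
      (integrable_trace_pow_mul_conj_trace_pow i _).mul_const _)]
    simp_rw [integral_mul_const]
    rw [Finset.sum_eq_zero fun i hi => ?_, mul_zero]
    rw [integral_trace_pow_mul_conj_trace_pow_eq_zero (fun h => by rw [mem_range] at hi; omega), zero_mul]
  exact_mod_cast h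

/-- **Even moments**: `∫_{U(N)} (Re tr U)^{2m} dU = 4^{−m} C(2m, m) ∫_{U(N)} |tr U|^{2m} dU`. -/
theorem integral_re_trace_pow_even (m : ℕ) :
    ∫ U, ((U : Matrix (Fin N) (Fin N) ℂ)).trace.re ^ (2 * m)
        ∂(haarProbability (Matrix.unitaryGroup (Fin N) ℂ))
      = ((2 * m).choose m : ℝ) / 4 ^ m *
          ∫ U, ‖((U : Matrix (Fin N) (Fin N) ℂ)).trace‖ ^ (2 * m) ∂(haarProbability (Matrix.unitaryGroup (Fin N) ℂ)) := by
  set μ := haarProbability (Matrix.unitaryGroup (Fin N) ℂ) with hμ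
  have h : ((∫ U, ((U : Matrix (Fin N) (Fin N) ℂ)).trace.re ^ (2 * m) ∂μ : ℝ) : ℂ)
      = ((((2 * m).choose m : ℝ) / 4 ^ m * ∫ U, ‖((U : Matrix (Fin N) (Fin N) ℂ)).trace‖ ^ (2 * m) ∂μ : ℝ) : ℂ) := by
    rw [← integral_complex_ofReal]
    simp_rw [ofReal_re_pow_eq_sum]
    rw [integral_const_mul, integral_finsetSum _ (fun i _ =>
      (integrable_trace_pow_mul_conj_trace_pow i _).mul_const _)]
    simp_rw [integral_mul_const]
    rw [Finset.sum_eq_single m (fun i hi him => ?_) (fun hm => absurd (mem_range.mpr (by omega)) hm)]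
    · have hsq : ∀ U : Matrix.unitaryGroup (Fin N) ℂ,
          ((U : Matrix (Fin N) (Fin N) ℂ)).trace ^ m * conj (((U : Matrix (Fin N) (Fin N) ℂ)).trace) ^ (2 * m - m)
            = ((‖((U : Matrix (Fin N) (Fin N) ℂ)).trace‖ ^ (2 * m) : ℝ) : ℂ) := by
        intro U
        rw [show 2 * m - m = m by omega, ← mul_pow, Complex.mul_conj, Complex.normSq_eq_norm_sq, pow_mul]
        push_cast
        ring
      simp_rw [hsq]
      rw [integral_complex_ofReal]
      push_cast
      rw [show ((2 : ℂ)⁻¹) ^ (2 * m) = 1 / 4 ^ m by rw [pow_mul, one_div, ← inv_pow]; norm_num]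
      ring
    · rw [integral_trace_pow_mul_conj_trace_pow_eq_zero (fun h => him (by omega)), zero_mul]
  exact_mod_cast h


/-! ### 3. The one-plaquette partition function `det[I_{|i−j|}(x)]` and its derivative as moment series -/

/-- **THE TAYLOR COEFFICIENTS OF `Z_N(x) = det[I_{|i−j|}(x)]_{N×N}` AT `x = 0` ARE THE MOMENTS OF `Re tr U`**:
`Z_N^{(k)}(0) = ∫_{U(N)} (Re tr U)^k dU` (the determinant is the moment generating function of `Re tr U`). -/
theorem iteratedDeriv_det_besselI_toeplitz_zero (N k : ℕ) :
    iteratedDeriv k (fun x : ℝ => (Matrix.of fun i j : Fin N => besselI ((i : ℤ) - (j : ℤ)).natAbs x).det) 0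
      = ∫ U, ((U : Matrix (Fin N) (Fin N) ℂ)).trace.re ^ k ∂(haarProbability (Matrix.unitaryGroup (Fin N) ℂ)) := by
  rw [← mgf_trace_re_unitaryGroup_eq, iteratedDeriv_mgf_zero (mem_interior_integrableExpSet_of_abs_le_const
    (aestronglyMeasurable_trace_re_unitaryGroup N) (fun u => abs_trace_re_le_card u) 0)]
  rfl

/-- **`Z_N(x) = Σ_k (x^k/k!) ∫_{U(N)} (Re tr U)^k dU`**: the one-plaquette partition function is the sum of
its (everywhere convergent) moment series. -/
theorem hasSum_integral_re_trace_pow (N : ℕ) (x : ℝ) :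
    HasSum (fun k : ℕ => x ^ k / k.factorial *
        ∫ U, ((U : Matrix (Fin N) (Fin N) ℂ)).trace.re ^ k ∂(haarProbability (Matrix.unitaryGroup (Fin N) ℂ)))
      ((Matrix.of fun i j : Fin N => besselI ((i : ℤ) - (j : ℤ)).natAbs x).det) := by
  set μ := haarProbability (Matrix.unitaryGroup (Fin N) ℂ) with hμ
  rw [← integral_haar_unitaryGroup_fin_exp_mul_trace_re]
  have key := hasSum_integral_of_dominated_convergence (μ := μ)
    (F := fun (k : ℕ) (U : Matrix.unitaryGroup (Fin N) ℂ) =>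
      x ^ k / k.factorial * ((U : Matrix (Fin N) (Fin N) ℂ)).trace.re ^ k)
    (f := fun U : Matrix.unitaryGroup (Fin N) ℂ => Real.exp (x * ((U : Matrix (Fin N) (Fin N) ℂ)).trace.re))
    (fun k _ => (|x| * N) ^ k / k.factorial) (fun k => ?_) (fun k => Filter.Eventually.of_forall fun U => ?_)
    (Filter.Eventually.of_forall fun U => Real.summable_pow_div_factorial _) (integrable_const _)
    (Filter.Eventually.of_forall fun U => ?_)
  · simpa only [integral_const_mul] using key
  · exact (continuous_const.mul ((Complex.continuous_re.comp
      (continuous_id.matrix_trace.comp continuous_subtype_val)).pow _)).aestronglyMeasurable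
  · rw [norm_mul, norm_div, norm_pow, Real.norm_eq_abs, Real.norm_natCast, norm_pow, Real.norm_eq_abs, mul_pow,
      div_mul_eq_mul_div]
    exact div_le_div_of_nonneg_right (mul_le_mul_of_nonneg_left
      (pow_le_pow_left₀ (abs_nonneg _) (abs_trace_re_le_card U |>.trans (by simp)) _) (pow_nonneg (abs_nonneg _) _))
      (Nat.cast_nonneg _)
  · have h := NormedSpace.expSeries_div_hasSum_exp (x * ((U : Matrix (Fin N) (Fin N) ℂ)).trace.re)
    rw [← Real.exp_eq_exp_ℝ] at h
    rw [show (fun k : ℕ => x ^ k / k.factorial * ((U : Matrix (Fin N) (Fin N) ℂ)).trace.re ^ k)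
        = fun n : ℕ => (x * ((U : Matrix (Fin N) (Fin N) ℂ)).trace.re) ^ n / n.factorial from
      funext fun k => by rw [mul_pow]; ring]
    exact h

/-- **`Z_N'(x) = Σ_k (x^k/k!) ∫_{U(N)} (Re tr U)^{k+1} dU`**: the moment series of the derivative
`Z_N'(x) = ∫ Re tr U · e^{x Re tr U} dU` (the tree's `hasDerivAt_det_besselI_toeplitz`), everywhere convergent. -/
theorem hasSum_integral_re_trace_pow_succ (N : ℕ) (x : ℝ) :
    HasSum (fun k : ℕ => x ^ k / k.factorial *
        ∫ U, ((U : Matrix (Fin N) (Fin N) ℂ)).trace.re ^ (k + 1) ∂(haarProbability (Matrix.unitaryGroup (Fin N) ℂ)))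
      (∫ U, ((U : Matrix (Fin N) (Fin N) ℂ)).trace.re *
          Real.exp (x * ((U : Matrix (Fin N) (Fin N) ℂ)).trace.re) ∂(haarProbability (Matrix.unitaryGroup (Fin N) ℂ))) := by
  set μ := haarProbability (Matrix.unitaryGroup (Fin N) ℂ) with hμ
  have key := hasSum_integral_of_dominated_convergence (μ := μ)
    (F := fun (k : ℕ) (U : Matrix.unitaryGroup (Fin N) ℂ) =>
      x ^ k / k.factorial * ((U : Matrix (Fin N) (Fin N) ℂ)).trace.re ^ (k + 1))
    (f := fun U : Matrix.unitaryGroup (Fin N) ℂ => ((U : Matrix (Fin N) (Fin N) ℂ)).trace.re *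
      Real.exp (x * ((U : Matrix (Fin N) (Fin N) ℂ)).trace.re))
    (fun k _ => (N : ℝ) * ((|x| * N) ^ k / k.factorial)) (fun k => ?_) (fun k => Filter.Eventually.of_forall fun U => ?_)
    (Filter.Eventually.of_forall fun U => (Real.summable_pow_div_factorial _).mul_left _) (integrable_const _)
    (Filter.Eventually.of_forall fun U => ?_)
  · simpa only [integral_const_mul] using key
  · exact (continuous_const.mul ((Complex.continuous_re.comp
      (continuous_id.matrix_trace.comp continuous_subtype_val)).pow _)).aestronglyMeasurable
  · have hN : |((U : Matrix (Fin N) (Fin N) ℂ)).trace.re| ≤ N := (abs_trace_re_le_card U).trans (by simp)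
    rw [norm_mul, norm_div, norm_pow, Real.norm_eq_abs, Real.norm_natCast, norm_pow, Real.norm_eq_abs, pow_succ,
      mul_pow, show |x| ^ k / (k.factorial : ℝ) * (|((U : Matrix (Fin N) (Fin N) ℂ)).trace.re| ^ k *
        |((U : Matrix (Fin N) (Fin N) ℂ)).trace.re|) = |((U : Matrix (Fin N) (Fin N) ℂ)).trace.re| *
        (|x| ^ k * |((U : Matrix (Fin N) (Fin N) ℂ)).trace.re| ^ k / k.factorial) by ring]
    exact mul_le_mul hN (div_le_div_of_nonneg_right (mul_le_mul_of_nonneg_left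
      (pow_le_pow_left₀ (abs_nonneg _) hN _) (pow_nonneg (abs_nonneg _) _)) (Nat.cast_nonneg _))
      (by positivity) (Nat.cast_nonneg _)
  · have h := (NormedSpace.expSeries_div_hasSum_exp (x * ((U : Matrix (Fin N) (Fin N) ℂ)).trace.re)).mul_left
      ((U : Matrix (Fin N) (Fin N) ℂ)).trace.re
    rw [← Real.exp_eq_exp_ℝ] at h
    rw [show (fun k : ℕ => x ^ k / k.factorial * ((U : Matrix (Fin N) (Fin N) ℂ)).trace.re ^ (k + 1))
        = fun n : ℕ => ((U : Matrix (Fin N) (Fin N) ℂ)).trace.re *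
          ((x * ((U : Matrix (Fin N) (Fin N) ℂ)).trace.re) ^ n / n.factorial) from
      funext fun k => by rw [mul_pow]; ring]
    exact h

end Summit.Ventures.LatticeQCDFlow.Scoring
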